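import Summits.Ventures.CertifiedArithmetic.LowPrec.SRTwoSumE2M1
import HarnessLib

/-!
# 2Sum under stochastic rounding is surely exact on FP4: all pairs, by the kernel (file XXXIX b)

HONEST FRAMING: certified error envelopes and provably optimal rounding/accumulation schemes for
low-precision formats under stated cost models; every table by two implementations; no hardware or
vendor claims.

Companion of `SRTwoSumE2M1`: for ALL `225` ordered pairs of the literal OCP FP4 (E2M1) table the
six nested saturating SR steps of 2Sum return `s + t = a + b` SURELY (`twoSumE_exact_e2m1`; the
indicator of exactness has expectation `1`; `decide +kernel` in five chunks) — on FP4, 2Sum with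
every operation stochastically rounded is an exact error-free transformation, saturating pairs
included.  Not so on E3M2 (`twoSum_not_sure_E3M2`, file XXXVIII: `P = 81/256` at `(24, 7/4)`).
Agrees with the two Python implementations `certs/sr/gen7/eft/TS_e2m1_{A,B}` (third route).
-/

namespace Summit.Ventures.CertifiedArithmetic.LowPrec.SR

open Literature.ComputerArithmetic.ConnollyHighamMary2021
open Literature.ComputerArithmetic.FloatingPoint
open Finset

/-- Chunk `a ∈ {-6, -4, -3, -2}` of the FP4 all-pairs check: `s + t = a + b` surely (kernel). -/
theorem twoSumE_exact_e2m1_negA : ∀ a ∈ ({-6, -4, -3, -2} : Finset ℚ), ∀ b ∈ FP4.e2m1,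
    twoSumE FP4.e2m1 a b (fun s t => if s + t = a + b then 1 else 0) = 1 := by
  decide +kernel

/-- Chunk `a ∈ {-3/2, -1, -1/2}` of the FP4 all-pairs check: `s + t = a + b` surely (kernel). -/
theorem twoSumE_exact_e2m1_negB : ∀ a ∈ ({-3 / 2, -1, -1 / 2} : Finset ℚ), ∀ b ∈ FP4.e2m1,
    twoSumE FP4.e2m1 a b (fun s t => if s + t = a + b then 1 else 0) = 1 := by
  decide +kernel

/-- Chunk `a ∈ {1/2, 1, 3/2, 2}` of the FP4 all-pairs check: `s + t = a + b` surely (kernel). -/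
theorem twoSumE_exact_e2m1_posA : ∀ a ∈ ({1 / 2, 1, 3 / 2, 2} : Finset ℚ), ∀ b ∈ FP4.e2m1,
    twoSumE FP4.e2m1 a b (fun s t => if s + t = a + b then 1 else 0) = 1 := by
  decide +kernel

/-- Chunk `a ∈ {3, 4, 6}` of the FP4 all-pairs check: `s + t = a + b` surely (kernel). -/
theorem twoSumE_exact_e2m1_posB : ∀ a ∈ ({3, 4, 6} : Finset ℚ), ∀ b ∈ FP4.e2m1,
    twoSumE FP4.e2m1 a b (fun s t => if s + t = a + b then 1 else 0) = 1 := by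
  decide +kernel

/-- Chunk `a = 0` of the FP4 all-pairs check: `s + t = a + b` surely (kernel). -/
theorem twoSumE_exact_e2m1_zero : ∀ b ∈ FP4.e2m1,
    twoSumE FP4.e2m1 0 b (fun s t => if s + t = 0 + b then 1 else 0) = 1 := by
  decide +kernel

/-- **E2M1: 2Sum under SR is EXACT SURELY on every pair of the FP4 table** (kernel, chunk by
chunk); not so in E3M2 (`twoSum_not_sure_E3M2`, file XXXVIII). -/
theorem twoSumE_exact_e2m1 : ∀ a ∈ FP4.e2m1, ∀ b ∈ FP4.e2m1,
    twoSumE FP4.e2m1 a b (fun s t => if s + t = a + b then 1 else 0) = 1 := by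
  intro a ha
  simp only [e2m1_split5, Finset.mem_union, Finset.mem_singleton] at ha
  rcases ha with (((h | h) | rfl) | h) | h
  · exact twoSumE_exact_e2m1_negA a h
  · exact twoSumE_exact_e2m1_negB a h
  · exact twoSumE_exact_e2m1_zero
  · exact twoSumE_exact_e2m1_posA a h
  · exact twoSumE_exact_e2m1_posB a h

end Summit.Ventures.CertifiedArithmetic.LowPrec.SR
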